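import Literature.NumberTheory.DiophantineGeometry.LocalReductionFiniteBadPlacesProofs
import Literature.NumberTheory.DiophantineGeometry.LocalReductionHasMultiplicativeReductionAtProofs
import Literature.NumberTheory.DiophantineGeometry.GenEllMellReduction
import Literature.NumberTheory.EllipticCurves.LegendreFormGoodModelProofs
import HarnessLib

/-!
# The Legendre equation `y² = x(x − 1)(x − λ)` at a place of odd residue characteristic:
# good reduction iff `λ, λ − 1` are units, MULTIPLICATIVE reduction if `λ ≡ 0, 1`, and the
# quadratic twist `u = √λ` (Silverman *AEC* VII.5.4 (c); [IUTchIV] Prop. 1.8 (vi), second sentence)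

`Proofs` file (theorems only; no definitions, no named facts, no instances), topic
`NumberTheory/EllipticCurves`; sequel of `LegendreFormValuation` (`legendre_Δ`, `legendre_c₄`:
`Δ = 16λ²(λ − 1)²`, `c₄ = 16(λ² − λ + 1)`) and `LegendreFormGoodModelProofs` (`legendre_isElliptic_iff`)
over the tree's reduction-type API `Literature.NumberTheory.DiophantineGeometry.LocalReduction*`
(`WeierstrassCurve.HasGoodReductionAt / HasMultiplicativeReductionAt / IsSemistableAt v W` for a
Weierstrass equation over the fraction field `K` of a Dedekind domain `A` at a finite place `v`).
Written by the cell `abc-iut` (seat abc-iut-w5-d231), DAG node `IUTchIV:Prop1.8(vi)`, as the REAL form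
(for Weierstrass equations, over `K` itself) of the case analysis behind the second sentence of

> S. Mochizuki, *Inter-universal Teichmüller theory IV*, Prop. 1.8 (vi) (kurims Apr-2020 manuscript,
> p. 19): "If, moreover, `k` is a complete discrete valuation field with algebraically closed residue
> field such that `2` is invertible in `O_k`, then `E_k` has semi-stable reduction over `O_{k′}` [i.e.,
> extends to a semi-abelian scheme over `O_{k′}`] for some finite extension `k′ ⊆ k̄` of `k` such that
> `[k′ : k] ≤ 2`; if `E_k` has good reduction over `O_{k′}` [i.e., extends to an abelian scheme over
> `O_{k′}`], then one may in fact take `k′` to be `k`."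

whose printed proof (p. 21) is: "The final portion of assertion (vi) concerning models of the Legendre
form over complete discrete valuation fields follows from [the proof of] [Silv], Chapter VII,
Proposition 5.4, (c)."  Silverman's Prop. VII.5.4 (c) and its proof (PDF pp. 176–177): for
`E : y² = x(x − 1)(x − λ)` over a local field with residue characteristic `≠ 2`, (1) `λ ∈ R`,
`λ ≢ 0, 1 (mod 𝔪)` ⟹ `Δ = 16λ²(λ − 1)² ∈ R^×`, good reduction; (2) `λ ∈ R`, `λ ≡ 0` or `1 (mod 𝔪)` ⟹
`Δ ∈ 𝔪`, `c₄ = 16(λ² − λ + 1) ∈ R^×`, (minimal equation with) MULTIPLICATIVE reduction; (3) `λ ∉ R`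
⟹ the substitution `x = λx′, y = λ^{3/2}y′` (over `K(√λ)`, degree `≤ 2`) gives the Legendre equation
of `1/λ ∈ 𝔪`, case (2).  Here, with `v` a height-one prime of a Dedekind domain `A`, `K = Frac A`,
`|2|_v = 1`, and the literal Legendre equation `⟨0, −(1 + λ), 0, λ, 0⟩` of `LegendreFormValuation`:

* `legendre_hasGoodReductionAt_of_valuation_eq_one` — case (1): `|λ|_v = |λ − 1|_v = 1` ⟹ good
  reduction at `v` (`hasGoodReductionAt_of_valuation_le_one_of_valuation_Δ_eq_one`);
* `legendre_hasMultiplicativeReductionAt_of_valuation_lt_one`, `…_of_valuation_sub_one_lt_one` —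
  case (2): `|λ|_v < 1` (resp. `|λ − 1|_v < 1`) ⟹ multiplicative reduction at `v` OVER `K`
  (`hasMultiplicativeReductionAt_of_valuation_c₄_eq_one`: integral, `|c₄|_v = 1`, `|Δ|_v < 1`);
* `legendre_isSemistableAt_of_valuation_le_one` — `|λ|_v ≤ 1` ⟹ semistable at `v` over `K`;
* `legendre_valuation_j_eq_sq_of_one_lt_valuation`, `legendre_not_hasGoodReductionAt_of_one_lt_valuation`
  — case (3) over `K`: `|λ|_v > 1` ⟹ `|j|_v = |λ|_v² > 1`, so NOT good reduction at `v`
  (`valuation_j_le_one_of_hasGoodReduction_localMinimalModel`);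
* **`legendre_hasGoodReductionAt_iff`** — good reduction at `v` ⟺ `|λ|_v = 1 ∧ |λ − 1|_v = 1`
  (the "one may in fact take `k′` to be `k`" clause, read over `K`: good reduction is decided by the
  `v`-adic units `λ, λ − 1`, a condition insensitive to unramified-or-not finite extensions);
* `variableChange_legendre_of_sq_eq` — case (3)'s substitution as an identity of Weierstrass equations
  over any field: `d² = λ`, `d ≠ 0` ⟹ `⟨d, 0, 0, 0⟩ • ⟨0, −(1 + λ), 0, λ, 0⟩ = ⟨0, −(1 + λ⁻¹), 0, λ⁻¹, 0⟩`;
* `legendre_hasMultiplicativeReductionAt_of_one_lt_valuation_of_sq_eq` — case (3) when `√λ ∈ K`: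
  `|λ|_v > 1`, `d² = λ` in `K` ⟹ multiplicative reduction at `v`
  (`hasMultiplicativeReductionAt_smul_iff_holds`); the base change to `K(√λ)` and the assembled
  printed sentence (`[k′ : k] ≤ 2`) are in the sequel `LegendreSemistableBaseChangeProofs`.

Classical and undisputed (Silverman *AEC* VII.5.4 (c)); nothing here bears on [IUTchIII] Cor. 3.12.

## References

* [SilvermanAEC2009] J. H. Silverman, *The Arithmetic of Elliptic Curves*, 2nd ed., GTM 106,
  Springer 2009: Prop. VII.5.4 (c) and its proof (PDF pp. 176–177), Prop. VII.5.1, Rem. VII.1.1,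
  Prop. III.1.7.
* [Mochizuki2012] S. Mochizuki, *Inter-universal Teichmüller theory IV*, Prop. 1.8 (vi) p. 19, proof
  p. 21 (kurims Apr-2020 manuscript).
-/

noncomputable section

open IsDedekindDomain

namespace Literature.NumberTheory.EllipticCurves

open _root_.WeierstrassCurve

/-! ### The substitution `x = λx′`, `y = λ√λ·y′` -/

section Algebra

variable {F : Type*} [Field F]

/-- **Silverman's case (3) substitution.** If `d² = λ ≠ 0` then the change of variables `u = d`
(`r = s = t = 0`), i.e. `x = d²x′`, `y = d³y′`, carries the Legendre equation of `λ` to the Legendre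
equation of `1/λ`: `⟨d, 0, 0, 0⟩ • (y² = x(x − 1)(x − λ)) = (y² = x(x − 1)(x − λ⁻¹))`
(`a₂′ = d⁻²a₂ = −(1 + λ)/λ`, `a₄′ = d⁻⁴a₄ = λ/λ² `). Silverman, *AEC*, proof of Prop. VII.5.4 (c),
Case 3 ("the substitution `x = λx′`, `y = λ^{3/2}y′`").
[cite: SilvermanAEC2009, proof of Prop. VII.5.4(c), Case 3 (PDF p. 177)] -/
theorem variableChange_legendre_of_sq_eq {la d : F} (hd0 : d ≠ 0) (hd : d ^ 2 = la) :
    (⟨Units.mk0 d hd0, 0, 0, 0⟩ : VariableChange F) • (⟨0, -(1 + la), 0, la, 0⟩ : WeierstrassCurve F) =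
      ⟨0, -(1 + la⁻¹), 0, la⁻¹, 0⟩ := by
  have hla0 : la ≠ 0 := by rw [← hd]; exact pow_ne_zero 2 hd0
  ext
  · simp [variableChange_a₁]
  · simp only [variableChange_a₂, Units.val_inv_eq_inv_val, Units.val_mk0]
    rw [inv_pow, hd]
    field_simp
    ring
  · simp [variableChange_a₃]
  · simp only [variableChange_a₄, Units.val_inv_eq_inv_val, Units.val_mk0]
    rw [inv_pow, show d ^ 4 = (d ^ 2) ^ 2 by ring, hd]
    field_simp
    ring
  · simp [variableChange_a₆]

end Algebra

/-! ### Reduction of the Legendre equation over `K` at a place `v` with `|2|_v = 1` -/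

section Reduction

variable {A : Type*} [CommRing A] [IsDedekindDomain A] {K : Type*} [Field K] [Algebra A K]
  [IsFractionRing A K] (v : HeightOneSpectrum A) {la : K}

/-- `|16|_v = 1` when `|2|_v = 1`. [folklore] -/
private theorem valuation_sixteen_eq_one (h2 : v.valuation K (2 : K) = 1) : v.valuation K (16 : K) = 1 := by
  rw [show (16 : K) = 2 ^ 4 by norm_num, map_pow, h2, one_pow]

/-- `|Δ|_v = |λ|_v² · |λ − 1|_v²` for the Legendre equation when `|2|_v = 1` (`Δ = 16λ²(λ − 1)²`).
Silverman, *AEC*, Prop. III.1.7 (proof). [cite: SilvermanAEC2009, Prop. III.1.7 (proof)] -/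
theorem valuation_legendre_Δ (h2 : v.valuation K (2 : K) = 1) (la : K) :
    v.valuation K (⟨0, -(1 + la), 0, la, 0⟩ : WeierstrassCurve K).Δ =
      v.valuation K la ^ 2 * v.valuation K (la - 1) ^ 2 := by
  rw [legendre_Δ, map_mul, map_mul, map_pow, map_pow, valuation_sixteen_eq_one v h2, one_mul]

/-- `|c₄|_v = |λ² − λ + 1|_v` for the Legendre equation when `|2|_v = 1` (`c₄ = 16(λ² − λ + 1)`).
Silverman, *AEC*, Prop. III.1.7 (proof). [cite: SilvermanAEC2009, Prop. III.1.7 (proof)] -/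
theorem valuation_legendre_c₄ (h2 : v.valuation K (2 : K) = 1) (la : K) :
    v.valuation K (⟨0, -(1 + la), 0, la, 0⟩ : WeierstrassCurve K).c₄ =
      v.valuation K (la ^ 2 - la + 1) := by
  rw [legendre_c₄, map_mul, valuation_sixteen_eq_one v h2, one_mul]

/-- The Legendre equation is `v`-integral as soon as `|λ|_v ≤ 1` (its coefficients are
`0, −(1 + λ), 0, λ, 0`). Silverman, *AEC*, proof of Prop. VII.5.4 (c) ("`λ ∈ R`").
[cite: SilvermanAEC2009, proof of Prop. VII.5.4(c) (PDF p. 176)] -/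
theorem legendre_isIntegralAt_of_valuation_le_one (hla : v.valuation K la ≤ 1) :
    (⟨0, -(1 + la), 0, la, 0⟩ : WeierstrassCurve K).IsIntegralAt v := by
  refine isIntegralAt_of_valuation_le_one v _ (by simp) ?_ (by simp) hla (by simp)
  show v.valuation K (-(1 + la)) ≤ 1
  rw [Valuation.map_neg]
  exact Valuation.map_add_le _ (by rw [Valuation.map_one]) hla

/-- **Case (1): `λ ≢ 0, 1` ⟹ good reduction.** If `|2|_v = 1` and `|λ|_v = |λ − 1|_v = 1`, the
Legendre equation `y² = x(x − 1)(x − λ)` is `v`-integral with unit discriminant `16λ²(λ − 1)²`, hence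
has good reduction at `v`. Silverman, *AEC*, proof of Prop. VII.5.4 (c), Case 1; [IUTchIV] Prop. 1.8
(vi) ("if `E_k` has good reduction over `O_{k′}`, then one may in fact take `k′` to be `k`" — the good
case happens over `k` itself). [cite: SilvermanAEC2009, proof of Prop. VII.5.4(c), Case 1 (PDF p. 176)]
[cite: Mochizuki2012, IUTchIV Prop 1.8 (vi) p.19] -/
theorem legendre_hasGoodReductionAt_of_valuation_eq_one (h2 : v.valuation K (2 : K) = 1)
    (hla : v.valuation K la = 1) (hla1 : v.valuation K (la - 1) = 1) :
    (⟨0, -(1 + la), 0, la, 0⟩ : WeierstrassCurve K).HasGoodReductionAt v := by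
  refine hasGoodReductionAt_of_valuation_le_one_of_valuation_Δ_eq_one v _ (by simp) ?_ (by simp)
    hla.le (by simp) ?_
  · show v.valuation K (-(1 + la)) ≤ 1
    rw [Valuation.map_neg]
    exact Valuation.map_add_le _ (by rw [Valuation.map_one]) hla.le
  · rw [valuation_legendre_Δ v h2, hla, hla1, one_pow, mul_one]

/-- **Case (2a): `λ ≡ 0 (mod 𝔪_v)` ⟹ multiplicative reduction over `K`.** If `|2|_v = 1` and
`|λ|_v < 1` (and the equation is an elliptic curve, i.e. `λ ≠ 0, 1`), then `y² = x(x − 1)(x − λ)` is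
`v`-integral with `|c₄|_v = |16(λ² − λ + 1)|_v = 1` and `|Δ|_v = |λ|_v² < 1`, hence (a minimal
equation with) multiplicative reduction at `v`. Silverman, *AEC*, proof of Prop. VII.5.4 (c), Case 2,
with Prop. VII.5.1 (b); [IUTchIV] Prop. 1.8 (vi), second sentence (semi-stable reduction).
[cite: SilvermanAEC2009, proof of Prop. VII.5.4(c), Case 2 (PDF p. 176) and Prop. VII.5.1(b)]
[cite: Mochizuki2012, IUTchIV Prop 1.8 (vi) p.19] -/
theorem legendre_hasMultiplicativeReductionAt_of_valuation_lt_one (h2 : v.valuation K (2 : K) = 1)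
    [hE : (⟨0, -(1 + la), 0, la, 0⟩ : WeierstrassCurve K).IsElliptic] (hla : v.valuation K la < 1) :
    (⟨0, -(1 + la), 0, la, 0⟩ : WeierstrassCurve K).HasMultiplicativeReductionAt v := by
  have hla1 : v.valuation K (la - 1) = 1 := by
    rw [Valuation.map_sub_eq_of_lt_right _ (by rwa [Valuation.map_one]), Valuation.map_one]
  refine hasMultiplicativeReductionAt_of_valuation_c₄_eq_one
    (legendre_isIntegralAt_of_valuation_le_one v hla.le) ?_ ?_
  · rw [valuation_legendre_c₄ v h2]
    have hlt : v.valuation K (la ^ 2 - la) < v.valuation K (1 : K) := by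
      rw [Valuation.map_one]
      refine lt_of_le_of_lt (Valuation.map_sub_le _ ?_ le_rfl) hla
      rw [map_pow]
      exact pow_le_of_le_one zero_le hla.le two_ne_zero
    rw [Valuation.map_add_eq_of_lt_right _ hlt, Valuation.map_one]
  · rw [valuation_legendre_Δ v h2, hla1, one_pow, mul_one]
    exact pow_lt_one₀ zero_le hla two_ne_zero

/-- **Case (2b): `λ ≡ 1 (mod 𝔪_v)` ⟹ multiplicative reduction over `K`.** If `|2|_v = 1` and
`|λ − 1|_v < 1` (elliptic case), then `y² = x(x − 1)(x − λ)` is `v`-integral with `|λ|_v = 1`,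
`|c₄|_v = |(λ − 1)² + (λ − 1) + 1|_v = 1` and `|Δ|_v = |λ − 1|_v² < 1`, hence has multiplicative
reduction at `v`. Silverman, *AEC*, proof of Prop. VII.5.4 (c), Case 2, with Prop. VII.5.1 (b);
[IUTchIV] Prop. 1.8 (vi), second sentence.
[cite: SilvermanAEC2009, proof of Prop. VII.5.4(c), Case 2 (PDF p. 176) and Prop. VII.5.1(b)]
[cite: Mochizuki2012, IUTchIV Prop 1.8 (vi) p.19] -/
theorem legendre_hasMultiplicativeReductionAt_of_valuation_sub_one_lt_one
    (h2 : v.valuation K (2 : K) = 1) [hE : (⟨0, -(1 + la), 0, la, 0⟩ : WeierstrassCurve K).IsElliptic]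
    (hla1 : v.valuation K (la - 1) < 1) :
    (⟨0, -(1 + la), 0, la, 0⟩ : WeierstrassCurve K).HasMultiplicativeReductionAt v := by
  have hla : v.valuation K la = 1 := by
    rw [show la = la - 1 + 1 by ring, Valuation.map_add_eq_of_lt_right _ (by rwa [Valuation.map_one]),
      Valuation.map_one]
  refine hasMultiplicativeReductionAt_of_valuation_c₄_eq_one
    (legendre_isIntegralAt_of_valuation_le_one v hla.le) ?_ ?_
  · rw [valuation_legendre_c₄ v h2]
    have hlt : v.valuation K ((la - 1) ^ 2 + (la - 1)) < v.valuation K (1 : K) := by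
      rw [Valuation.map_one]
      refine lt_of_le_of_lt (Valuation.map_add_le _ ?_ le_rfl) hla1
      rw [map_pow]
      exact pow_le_of_le_one zero_le hla1.le two_ne_zero
    rw [show la ^ 2 - la + 1 = (la - 1) ^ 2 + (la - 1) + 1 by ring,
      Valuation.map_add_eq_of_lt_right _ hlt, Valuation.map_one]
  · rw [valuation_legendre_Δ v h2, hla, one_pow, one_mul]
    exact pow_lt_one₀ zero_le hla1 two_ne_zero

/-- **`λ ∈ O_v` ⟹ semi-stable reduction over `K` itself.** If `|2|_v = 1` and `|λ|_v ≤ 1` (elliptic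
case), the Legendre equation has good (`λ ≢ 0, 1`) or multiplicative (`λ ≡ 0` or `1`) reduction at `v`.
Silverman, *AEC*, proof of Prop. VII.5.4 (c), Cases 1–2; [IUTchIV] Prop. 1.8 (vi), second sentence
(here no extension `k′` is needed). [cite: SilvermanAEC2009, proof of Prop. VII.5.4(c), Cases 1–2 (PDF p. 176)]
[cite: Mochizuki2012, IUTchIV Prop 1.8 (vi) p.19] -/
theorem legendre_isSemistableAt_of_valuation_le_one (h2 : v.valuation K (2 : K) = 1)
    [hE : (⟨0, -(1 + la), 0, la, 0⟩ : WeierstrassCurve K).IsElliptic] (hla : v.valuation K la ≤ 1) :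
    (⟨0, -(1 + la), 0, la, 0⟩ : WeierstrassCurve K).IsSemistableAt v := by
  rcases hla.lt_or_eq with hlt | heq
  · exact (legendre_hasMultiplicativeReductionAt_of_valuation_lt_one v h2 hlt).isSemistableAt
  · have hle1 : v.valuation K (la - 1) ≤ 1 :=
      Valuation.map_sub_le _ heq.le (by rw [Valuation.map_one])
    rcases hle1.lt_or_eq with hlt1 | heq1
    · exact (legendre_hasMultiplicativeReductionAt_of_valuation_sub_one_lt_one v h2 hlt1).isSemistableAt
    · exact (legendre_hasGoodReductionAt_of_valuation_eq_one v h2 heq heq1).isSemistableAt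

/-- **Case (3) over `K`: `λ ∉ O_v` ⟹ `|j|_v = |λ|_v² > 1`.** If `|2|_v = 1` and `|λ|_v > 1`, then from
`j · Δ = c₄³`, `Δ = 16λ²(λ − 1)²`, `c₄ = 16(λ² − λ + 1)` and `|λ − 1|_v = |λ|_v`,
`|λ² − λ + 1|_v = |λ|_v²` one gets `|j|_v · |λ|_v⁴ = |λ|_v⁶`. Silverman, *AEC*, proof of
Prop. VII.5.4 (c), Case 3 / Prop. VII.5.5 (`j` non-integral).
[cite: SilvermanAEC2009, proof of Prop. VII.5.4(c), Case 3 (PDF p. 177) and Prop. III.1.7(b)] -/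
theorem legendre_valuation_j_eq_sq_of_one_lt_valuation (h2 : v.valuation K (2 : K) = 1)
    [hE : (⟨0, -(1 + la), 0, la, 0⟩ : WeierstrassCurve K).IsElliptic] (hla : 1 < v.valuation K la) :
    v.valuation K (⟨0, -(1 + la), 0, la, 0⟩ : WeierstrassCurve K).j = v.valuation K la ^ 2 := by
  set V : WeierstrassCurve K := ⟨0, -(1 + la), 0, la, 0⟩ with hV
  set val := v.valuation K with hval
  have hrel : V.j * V.Δ = V.c₄ ^ 3 := by
    rw [WeierstrassCurve.j, ← V.coe_Δ', mul_comm, ← mul_assoc, Units.mul_inv, one_mul]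
  have hkey : val V.j * (val la ^ 2 * val (la - 1) ^ 2) = val (la ^ 2 - la + 1) ^ 3 := by
    have h := congrArg val hrel
    rwa [map_mul, map_pow, valuation_legendre_Δ v h2, valuation_legendre_c₄ v h2] at h
  have hl1 : val (la - 1) = val la := by
    rw [Valuation.map_sub_eq_of_lt_left _ (by rwa [Valuation.map_one])]
  have hq : val (la ^ 2 - la + 1) = val la ^ 2 := by
    have hlt2 : val la < val la ^ 2 := by
      conv_lhs => rw [← pow_one (val la)]
      exact pow_lt_pow_right₀ hla one_lt_two
    rw [show la ^ 2 - la + 1 = la ^ 2 - (la - 1) by ring,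
      Valuation.map_sub_eq_of_lt_left _ (by rwa [map_pow, hl1]), map_pow]
  rw [hl1, hq, ← pow_mul, ← pow_add] at hkey
  have hla0 : val la ≠ 0 := (lt_trans zero_lt_one hla).ne'
  have h46 : val la ^ (2 * 3) = val la ^ 2 * val la ^ (2 + 2) := by
    rw [← pow_add]
  rw [h46] at hkey
  exact mul_right_cancel₀ (pow_ne_zero _ hla0) hkey

/-- **Case (3) over `K`: `λ ∉ O_v` ⟹ NOT good reduction at `v`** (`|j|_v = |λ|_v² > 1`, whereas good
reduction forces `|j|_v ≤ 1`, `valuation_j_le_one_of_hasGoodReduction_localMinimalModel`). Silverman,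
*AEC*, Prop. VII.5.5 / proof of Prop. VII.5.4 (c), Case 3.
[cite: SilvermanAEC2009, Prop. VII.5.5 and proof of Prop. VII.5.4(c), Case 3 (PDF p. 177)] -/
theorem legendre_not_hasGoodReductionAt_of_one_lt_valuation (h2 : v.valuation K (2 : K) = 1)
    [hE : (⟨0, -(1 + la), 0, la, 0⟩ : WeierstrassCurve K).IsElliptic] (hla : 1 < v.valuation K la) :
    ¬ (⟨0, -(1 + la), 0, la, 0⟩ : WeierstrassCurve K).HasGoodReductionAt v := by
  intro hgood
  have hj := Literature.NumberTheory.DiophantineGeometry.GenEll.valuation_j_le_one_of_hasGoodReduction_localMinimalModel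
    v _ hgood
  rw [legendre_valuation_j_eq_sq_of_one_lt_valuation v h2 hla] at hj
  exact (one_lt_pow₀ hla two_ne_zero).not_ge hj

/-- **Good reduction of the Legendre equation is decided by the units `λ, λ − 1`.** For `|2|_v = 1` and
`λ ≠ 0, 1`: `y² = x(x − 1)(x − λ)` has good reduction at `v` iff `|λ|_v = 1` and `|λ − 1|_v = 1` — the
other cases are multiplicative (`λ ≡ 0, 1`) or have `|j|_v > 1` (`λ ∉ O_v`). Silverman, *AEC*, proof
of Prop. VII.5.4 (c); this is the content of [IUTchIV] Prop. 1.8 (vi) "if `E_k` has good reduction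
over `O_{k′}`, then one may in fact take `k′` to be `k`" (the criterion does not see the extension).
[cite: SilvermanAEC2009, proof of Prop. VII.5.4(c) (PDF pp. 176–177)]
[cite: Mochizuki2012, IUTchIV Prop 1.8 (vi) p.19] -/
theorem legendre_hasGoodReductionAt_iff (h2 : v.valuation K (2 : K) = 1)
    [hE : (⟨0, -(1 + la), 0, la, 0⟩ : WeierstrassCurve K).IsElliptic] :
    (⟨0, -(1 + la), 0, la, 0⟩ : WeierstrassCurve K).HasGoodReductionAt v ↔
      v.valuation K la = 1 ∧ v.valuation K (la - 1) = 1 := by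
  refine ⟨fun hgood ↦ ?_, fun h ↦ legendre_hasGoodReductionAt_of_valuation_eq_one v h2 h.1 h.2⟩
  rcases lt_trichotomy (v.valuation K la) 1 with hlt | heq | hgt
  · exact absurd (legendre_hasMultiplicativeReductionAt_of_valuation_lt_one v h2 hlt)
      hgood.not_hasMultiplicativeReductionAt
  · refine ⟨heq, ?_⟩
    have hle1 : v.valuation K (la - 1) ≤ 1 :=
      Valuation.map_sub_le _ heq.le (by rw [Valuation.map_one])
    rcases hle1.lt_or_eq with hlt1 | heq1
    · exact absurd (legendre_hasMultiplicativeReductionAt_of_valuation_sub_one_lt_one v h2 hlt1)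
        hgood.not_hasMultiplicativeReductionAt
    · exact heq1
  · exact absurd hgood (legendre_not_hasGoodReductionAt_of_one_lt_valuation v h2 hgt)

/-- **Case (3) when `√λ ∈ K`: multiplicative reduction.** If `|2|_v = 1`, `|λ|_v > 1` and `d² = λ` for
some `d ∈ K`, then `y² = x(x − 1)(x − λ)` has multiplicative reduction at `v`: it is `K`-isomorphic
(`u = d`) to the Legendre equation of `λ⁻¹`, and `|λ⁻¹|_v < 1` is Case (2a); the reduction type of an
elliptic curve does not depend on the equation (`hasMultiplicativeReductionAt_smul_iff_holds`).
Silverman, *AEC*, proof of Prop. VII.5.4 (c), Case 3; [IUTchIV] Prop. 1.8 (vi), second sentence.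
[cite: SilvermanAEC2009, proof of Prop. VII.5.4(c), Case 3 (PDF p. 177)]
[cite: Mochizuki2012, IUTchIV Prop 1.8 (vi) p.19] -/
theorem legendre_hasMultiplicativeReductionAt_of_one_lt_valuation_of_sq_eq
    (h2 : v.valuation K (2 : K) = 1) [hE : (⟨0, -(1 + la), 0, la, 0⟩ : WeierstrassCurve K).IsElliptic]
    (hla : 1 < v.valuation K la) {d : K} (hd : d ^ 2 = la) :
    (⟨0, -(1 + la), 0, la, 0⟩ : WeierstrassCurve K).HasMultiplicativeReductionAt v := by
  have h20 : (2 : K) ≠ 0 := fun h ↦ by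
    rw [h, Valuation.map_zero] at h2
    exact zero_ne_one h2
  obtain ⟨hla0, hla1⟩ := (legendre_isElliptic_iff h20 la).mp hE
  have hd0 : d ≠ 0 := by
    rintro rfl
    exact hla0 (by rw [← hd]; ring)
  -- the Legendre equation of `λ⁻¹` is elliptic and has `|λ⁻¹|_v < 1`
  haveI hE' : (⟨0, -(1 + la⁻¹), 0, la⁻¹, 0⟩ : WeierstrassCurve K).IsElliptic :=
    (legendre_isElliptic_iff h20 la⁻¹).mpr ⟨inv_ne_zero hla0, fun h ↦ hla1 (inv_eq_one.mp h)⟩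
  have hinv : v.valuation K la⁻¹ < 1 := by
    rw [map_inv₀]
    exact inv_lt_one_of_one_lt₀ hla
  have hmul := legendre_hasMultiplicativeReductionAt_of_valuation_lt_one v h2 hinv
  rw [← variableChange_legendre_of_sq_eq hd0 hd] at hmul
  exact (hasMultiplicativeReductionAt_smul_iff_holds v _ _).mp hmul

end Reduction

end Literature.NumberTheory.EllipticCurves

end
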